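import Mathlib
import Literature.Analysis.OperatorTheory.BandedEigenvectorRegularity

/-!
# Regularity bootstrap for eigenvectors of a diagonal operator under a banded FIRST-ORDER perturbation

Topic `Literature/Analysis/OperatorTheory`; companion of `BandedEigenvectorRegularity.lean` (bounded
banded perturbations). Here the perturbation is of **first order relative to the diagonal part**: in the
eigenbasis `e` of the unperturbed operator `diag(ℓ)` (levels `ℓ_i`, think `ℓ_i = −ν|k_i|²`) it is an
infinite matrix `a` supported on a symmetric band `j ∈ nbr i` of width `≤ W` with entries growing like
the SQUARE ROOT of the levels, `‖a i j‖ ≤ K w_j`, where the weights satisfy `0 ≤ w_i`, `w_i² ≤ 1 + |ℓ_i|`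
(think `w_i = (1 + |ℓ_i|)^{1/2} ~ |k_i|`) and are comparable along the band (`w_i ≤ L w_j`). This is the
shape of a first-order differential operator with trigonometric-polynomial coefficients acting between
Fourier modes (the linearised Navier–Stokes operator about an ABC flow: cell `ns-blowup`, MODEL lane,
WHAT THIS IS NOT: not NS).

For an eigenvector in coefficient form, `ℓ_i c_i + Σ_{j ∈ nbr i} a_ij c_j = λ c_i` (`c_i = ⟪e_i, f⟫`,
`λ ∈ 𝕜` possibly complex), the Sobolev-type scale `N_s(f) = Σ_i w_i^{2s} |c_i|²` (`sobSum`) obeys the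
TWO-STEP bootstrap

* `sobSum_add_two_le_of_eigen`: `N_{s+2}(f) ≤ 2(1+‖λ‖)² N_s(f) + 2 K² W² L^{2s} N_{s+1}(f)`
  (the second-order diagonal part controls two more weights, the first-order band costs one);
* `sobSum_ne_top_of_eigen`: hence if `N_1(f) < ∞` (the eigenvector lies in the form domain — automatic
  for eigenvectors produced in the operator domain `N_2 < ∞`), then `N_s(f) < ∞` for EVERY `s`: the
  coefficients decay faster than any power of the weights (`summable_weighted_of_eigen`, real form).

This is the Fourier-coefficient form of interior elliptic regularity by bootstrapping the eigenvalue
equation (Evans, *PDE*, §6.3.1 Thm 3; Reed–Simon IV §XIII.16 for the periodic/torus setting); no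
absorption argument is needed because the recursion is two-step and monotone in `ℝ≥0∞`.

## References
* L. C. Evans, *Partial Differential Equations*, 2nd ed., AMS GSM 19 (2010), §6.3.1, Theorem 3
  (infinite differentiability in the interior). [Evans2010]
* M. Reed, B. Simon, *Methods of Modern Mathematical Physics IV* (1978), §XIII.16. [ReedSimonIV1978]
-/

noncomputable section

open scoped BigOperators InnerProductSpace ENNReal

namespace Literature.Analysis.OperatorTheory

namespace FirstOrderBand

variable {ι : Type*} {𝕜 : Type*} [RCLike 𝕜]
variable {H : Type*} [NormedAddCommGroup H] [InnerProductSpace 𝕜 H]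
variable {e : HilbertBasis ι 𝕜 H} {w : ι → ℝ} {ℓ : ι → ℝ} {nbr : ι → Finset ι} {a : ι → ι → 𝕜}
variable {K L : ℝ} {W : ℕ} {f : H} {lam : 𝕜}

/-- The pointwise estimate behind the bootstrap: from `ℓ_i c_i + Σ_{j ∈ nbr i} a_ij c_j = λ c_i`,
`‖a_ij‖ ≤ K w_j` and `w_i² ≤ 1 + |ℓ_i|`:  `w_i² ‖c_i‖ ≤ (1 + ‖λ‖) ‖c_i‖ + K Σ_{j ∈ nbr i} w_j ‖c_j‖`.
[folklore] -/
private theorem weight_sq_mul_norm_le (hwℓ : ∀ i, w i ^ 2 ≤ 1 + |ℓ i|)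
    (ha : ∀ i j, j ∈ nbr i → ‖a i j‖ ≤ K * w j)
    (heig : ∀ i, (ℓ i : 𝕜) * ⟪e i, f⟫_𝕜 + ∑ j ∈ nbr i, a i j * ⟪e j, f⟫_𝕜 = lam * ⟪e i, f⟫_𝕜)
    (i : ι) :
    w i ^ 2 * ‖⟪e i, f⟫_𝕜‖ ≤
      (1 + ‖lam‖) * ‖⟪e i, f⟫_𝕜‖ + K * ∑ j ∈ nbr i, w j * ‖⟪e j, f⟫_𝕜‖ := by
  have h1 : ((ℓ i : 𝕜) - lam) * ⟪e i, f⟫_𝕜 = -∑ j ∈ nbr i, a i j * ⟪e j, f⟫_𝕜 := by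
    rw [sub_mul, sub_eq_iff_eq_add, neg_add_eq_sub, eq_sub_iff_add_eq]
    exact heig i
  -- `|ℓ_i - λ| ‖c_i‖ ≤ Σ ‖a_ij‖ ‖c_j‖ ≤ K Σ w_j ‖c_j‖`
  have h2 : ‖(ℓ i : 𝕜) - lam‖ * ‖⟪e i, f⟫_𝕜‖ ≤ K * ∑ j ∈ nbr i, w j * ‖⟪e j, f⟫_𝕜‖ := by
    rw [← norm_mul, h1, norm_neg]
    refine (norm_sum_le _ _).trans ?_
    rw [Finset.mul_sum]
    refine Finset.sum_le_sum fun j hj => ?_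
    rw [norm_mul, ← mul_assoc]
    exact mul_le_mul_of_nonneg_right (ha i j hj) (norm_nonneg _)
  -- `|ℓ_i| ≤ |ℓ_i - λ| + ‖λ‖`
  have h3 : |ℓ i| ≤ ‖(ℓ i : 𝕜) - lam‖ + ‖lam‖ := by
    have : ‖(ℓ i : 𝕜)‖ ≤ ‖(ℓ i : 𝕜) - lam‖ + ‖lam‖ := norm_le_norm_sub_add _ _
    rwa [RCLike.norm_ofReal] at this
  have hci : 0 ≤ ‖⟪e i, f⟫_𝕜‖ := norm_nonneg _
  calc w i ^ 2 * ‖⟪e i, f⟫_𝕜‖ ≤ (1 + |ℓ i|) * ‖⟪e i, f⟫_𝕜‖ :=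
        mul_le_mul_of_nonneg_right (hwℓ i) hci
    _ ≤ (1 + (‖(ℓ i : 𝕜) - lam‖ + ‖lam‖)) * ‖⟪e i, f⟫_𝕜‖ := by gcongr
    _ = (1 + ‖lam‖) * ‖⟪e i, f⟫_𝕜‖ + ‖(ℓ i : 𝕜) - lam‖ * ‖⟪e i, f⟫_𝕜‖ := by ring
    _ ≤ (1 + ‖lam‖) * ‖⟪e i, f⟫_𝕜‖ + K * ∑ j ∈ nbr i, w j * ‖⟪e j, f⟫_𝕜‖ := by gcongr

/-- The termwise level inequality (pure real bookkeeping): from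
`w_i² c_i ≤ (1+Λ) c_i + K Σ_{j ∈ nbr i} w_j c_j` one gets `w_i^{2(s+2)} c_i² ≤ 2(1+Λ)² w_i^{2s} c_i²
+ 2 K² L^{2s} W Σ_{j ∈ nbr i} w_j^{2(s+1)} c_j²`. [folklore] -/
private theorem term_le (hw0 : ∀ i, 0 ≤ w i) (hK : 0 ≤ K) (hW : ∀ i, (nbr i).card ≤ W)
    (hLnn : 0 ≤ L) (hL : ∀ i j, j ∈ nbr i → w i ≤ L * w j) {c : ι → ℝ} (hc0 : ∀ j, 0 ≤ c j)
    {Λ : ℝ} (i : ι) (hkey : w i ^ 2 * c i ≤ (1 + Λ) * c i + K * ∑ j ∈ nbr i, w j * c j)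
    (s : ℕ) :
    w i ^ (2 * (s + 2)) * c i ^ 2 ≤
      2 * (1 + Λ) ^ 2 * (w i ^ (2 * s) * c i ^ 2) +
        2 * K ^ 2 * L ^ (2 * s) * W * ∑ j ∈ nbr i, w j ^ (2 * (s + 1)) * c j ^ 2 := by
  -- `X := w_i^{s+2} c_i ≤ A + B`, `A := (1+Λ) w_i^s c_i`, `B := K L^s Σ_j w_j^{s+1} c_j`
  have hLs : 0 ≤ L ^ s := pow_nonneg hLnn s
  have hX : w i ^ (s + 2) * c i ≤
      (1 + Λ) * (w i ^ s * c i) + K * L ^ s * ∑ j ∈ nbr i, w j ^ (s + 1) * c j := by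
    have h1 : w i ^ (s + 2) * c i = w i ^ s * (w i ^ 2 * c i) := by ring
    rw [h1]
    refine (mul_le_mul_of_nonneg_left hkey (pow_nonneg (hw0 i) s)).trans ?_
    have h2 : w i ^ s * ((1 + Λ) * c i + K * ∑ j ∈ nbr i, w j * c j) =
        (1 + Λ) * (w i ^ s * c i) + K * (w i ^ s * ∑ j ∈ nbr i, w j * c j) := by ring
    rw [h2]
    refine add_le_add le_rfl ?_
    rw [mul_assoc]
    refine mul_le_mul_of_nonneg_left ?_ hK
    rw [Finset.mul_sum, Finset.mul_sum]
    refine Finset.sum_le_sum fun j hj => ?_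
    -- `w_i^s w_j c_j ≤ L^s w_j^s w_j c_j`
    have : w i ^ s ≤ L ^ s * w j ^ s := by
      rw [← mul_pow]; exact pow_le_pow_left₀ (hw0 i) (hL i j hj) s
    calc w i ^ s * (w j * c j) ≤ (L ^ s * w j ^ s) * (w j * c j) :=
          mul_le_mul_of_nonneg_right this (mul_nonneg (hw0 j) (hc0 j))
      _ = L ^ s * (w j ^ (s + 1) * c j) := by ring
  have hX0 : 0 ≤ w i ^ (s + 2) * c i := mul_nonneg (pow_nonneg (hw0 i) _) (hc0 i)
  have hsum0 : 0 ≤ ∑ j ∈ nbr i, w j ^ (2 * (s + 1)) * c j ^ 2 :=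
    Finset.sum_nonneg fun j _ => mul_nonneg (pow_nonneg (hw0 j) _) (sq_nonneg _)
  have hB2 : (K * L ^ s * ∑ j ∈ nbr i, w j ^ (s + 1) * c j) ^ 2 ≤
      K ^ 2 * L ^ (2 * s) * W * ∑ j ∈ nbr i, w j ^ (2 * (s + 1)) * c j ^ 2 := by
    have hcs := sq_sum_le_card_mul_sum_sq (s := nbr i) (f := fun j => w j ^ (s + 1) * c j)
    have hterm : ∀ j, (w j ^ (s + 1) * c j) ^ 2 = w j ^ (2 * (s + 1)) * c j ^ 2 := fun j => by ring
    simp only [hterm] at hcs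
    have hcard : ((nbr i).card : ℝ) * ∑ j ∈ nbr i, w j ^ (2 * (s + 1)) * c j ^ 2 ≤
        W * ∑ j ∈ nbr i, w j ^ (2 * (s + 1)) * c j ^ 2 :=
      mul_le_mul_of_nonneg_right (by exact_mod_cast hW i) hsum0
    have hKL : 0 ≤ K ^ 2 * L ^ (2 * s) := mul_nonneg (sq_nonneg K) (pow_nonneg hLnn _)
    calc (K * L ^ s * ∑ j ∈ nbr i, w j ^ (s + 1) * c j) ^ 2
        = K ^ 2 * L ^ (2 * s) * (∑ j ∈ nbr i, w j ^ (s + 1) * c j) ^ 2 := by ring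
      _ ≤ K ^ 2 * L ^ (2 * s) * (W * ∑ j ∈ nbr i, w j ^ (2 * (s + 1)) * c j ^ 2) :=
          mul_le_mul_of_nonneg_left (hcs.trans hcard) hKL
      _ = K ^ 2 * L ^ (2 * s) * W * ∑ j ∈ nbr i, w j ^ (2 * (s + 1)) * c j ^ 2 := by ring
  -- `(A + B)² ≤ 2A² + 2B²`
  set A : ℝ := (1 + Λ) * (w i ^ s * c i) with hA
  set B : ℝ := K * L ^ s * ∑ j ∈ nbr i, w j ^ (s + 1) * c j with hB
  have hsq : (w i ^ (s + 2) * c i) ^ 2 ≤ 2 * A ^ 2 + 2 * B ^ 2 := by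
    nlinarith [sq_nonneg (A - B), hX, hX0]
  have hA2 : 2 * A ^ 2 = 2 * (1 + Λ) ^ 2 * (w i ^ (2 * s) * c i ^ 2) := by rw [hA]; ring
  calc w i ^ (2 * (s + 2)) * c i ^ 2 = (w i ^ (s + 2) * c i) ^ 2 := by ring
    _ ≤ 2 * A ^ 2 + 2 * B ^ 2 := hsq
    _ ≤ 2 * (1 + Λ) ^ 2 * (w i ^ (2 * s) * c i ^ 2) +
        2 * K ^ 2 * L ^ (2 * s) * W * ∑ j ∈ nbr i, w j ^ (2 * (s + 1)) * c j ^ 2 := by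
        rw [hA2]
        refine add_le_add le_rfl ?_
        have := mul_le_mul_of_nonneg_left hB2 (show (0 : ℝ) ≤ 2 by norm_num)
        refine this.trans (le_of_eq ?_)
        ring

/-- **Two-step bootstrap** for an eigenvector of `diag(ℓ) + a` with a banded first-order `a`:
`N_{s+2}(f) ≤ 2(1+‖λ‖)² N_s(f) + 2 K² W² L^{2s} N_{s+1}(f)`. [cite: Evans2010, §6.3.1 Thm 3] -/
theorem sobSum_add_two_le_of_eigen (hw0 : ∀ i, 0 ≤ w i) (hwℓ : ∀ i, w i ^ 2 ≤ 1 + |ℓ i|)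
    (hK : 0 ≤ K) (ha : ∀ i j, j ∈ nbr i → ‖a i j‖ ≤ K * w j)
    (hsymm : ∀ i j, j ∈ nbr i ↔ i ∈ nbr j) (hW : ∀ i, (nbr i).card ≤ W) (hLnn : 0 ≤ L)
    (hL : ∀ i j, j ∈ nbr i → w i ≤ L * w j)
    (heig : ∀ i, (ℓ i : 𝕜) * ⟪e i, f⟫_𝕜 + ∑ j ∈ nbr i, a i j * ⟪e j, f⟫_𝕜 = lam * ⟪e i, f⟫_𝕜)
    (s : ℕ) :
    sobSum e w (s + 2) f ≤ ENNReal.ofReal (2 * (1 + ‖lam‖) ^ 2) * sobSum e w s f +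
      ENNReal.ofReal (2 * K ^ 2 * W ^ 2 * L ^ (2 * s)) * sobSum e w (s + 1) f := by
  have hnn : ∀ (t : ℕ) j, 0 ≤ w j ^ (2 * t) * ‖⟪e j, f⟫_𝕜‖ ^ 2 := fun t j =>
    mul_nonneg (pow_nonneg (hw0 j) _) (sq_nonneg _)
  have hc1 : 0 ≤ 2 * (1 + ‖lam‖) ^ 2 := by positivity
  have hc2 : 0 ≤ 2 * K ^ 2 * L ^ (2 * s) * (W : ℝ) :=
    mul_nonneg (mul_nonneg (mul_nonneg (by norm_num) (sq_nonneg K)) (pow_nonneg hLnn _))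
      (Nat.cast_nonneg W)
  have hterm : ∀ i, ENNReal.ofReal (w i ^ (2 * (s + 2)) * ‖⟪e i, f⟫_𝕜‖ ^ 2) ≤
      ENNReal.ofReal (2 * (1 + ‖lam‖) ^ 2) * ENNReal.ofReal (w i ^ (2 * s) * ‖⟪e i, f⟫_𝕜‖ ^ 2) +
        ENNReal.ofReal (2 * K ^ 2 * L ^ (2 * s) * W) *
          ∑ j ∈ nbr i, ENNReal.ofReal (w j ^ (2 * (s + 1)) * ‖⟪e j, f⟫_𝕜‖ ^ 2) := fun i => by
    rw [← ENNReal.ofReal_mul hc1,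
      ← ENNReal.ofReal_sum_of_nonneg (fun j _ => hnn (s + 1) j),
      ← ENNReal.ofReal_mul hc2, ← ENNReal.ofReal_add (mul_nonneg hc1 (hnn s i))
        (mul_nonneg hc2 (Finset.sum_nonneg fun j _ => hnn (s + 1) j))]
    have h := term_le (c := fun j => ‖⟪e j, f⟫_𝕜‖) hw0 hK hW hLnn hL (fun j => norm_nonneg _)
      i (weight_sq_mul_norm_le hwℓ ha heig i) s
    exact ENNReal.ofReal_le_ofReal h
  calc sobSum e w (s + 2) f
      ≤ ∑' i, (ENNReal.ofReal (2 * (1 + ‖lam‖) ^ 2) *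
            ENNReal.ofReal (w i ^ (2 * s) * ‖⟪e i, f⟫_𝕜‖ ^ 2) +
          ENNReal.ofReal (2 * K ^ 2 * L ^ (2 * s) * W) *
            ∑ j ∈ nbr i, ENNReal.ofReal (w j ^ (2 * (s + 1)) * ‖⟪e j, f⟫_𝕜‖ ^ 2)) :=
        ENNReal.tsum_le_tsum hterm
    _ = ENNReal.ofReal (2 * (1 + ‖lam‖) ^ 2) * sobSum e w s f +
          ENNReal.ofReal (2 * K ^ 2 * L ^ (2 * s) * W) *
            ∑' i, ∑ j ∈ nbr i, ENNReal.ofReal (w j ^ (2 * (s + 1)) * ‖⟪e j, f⟫_𝕜‖ ^ 2) := by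
        rw [ENNReal.tsum_add, ENNReal.tsum_mul_left, ENNReal.tsum_mul_left]
        rfl
    _ ≤ ENNReal.ofReal (2 * (1 + ‖lam‖) ^ 2) * sobSum e w s f +
          ENNReal.ofReal (2 * K ^ 2 * L ^ (2 * s) * W) * (W * sobSum e w (s + 1) f) :=
        add_le_add le_rfl (mul_le_mul' le_rfl (tsum_sum_nbr_le hsymm hW _))
    _ = ENNReal.ofReal (2 * (1 + ‖lam‖) ^ 2) * sobSum e w s f +
          ENNReal.ofReal (2 * K ^ 2 * W ^ 2 * L ^ (2 * s)) * sobSum e w (s + 1) f := by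
        rw [← mul_assoc, ← ENNReal.ofReal_natCast, ← ENNReal.ofReal_mul hc2]
        congr 2
        ring

/-- **All orders**: if `N_1(f) < ∞` (finite form-level energy — automatic for eigenvectors lying in
the domain `N_2 < ∞` of the unperturbed operator), then `N_s(f) < ∞` for every `s`: the coefficients
of the eigenvector decay faster than any power of the weights. [cite: Evans2010, §6.3.1 Thm 3] -/
theorem sobSum_ne_top_of_eigen (hw0 : ∀ i, 0 ≤ w i) (hwℓ : ∀ i, w i ^ 2 ≤ 1 + |ℓ i|)
    (hK : 0 ≤ K) (ha : ∀ i j, j ∈ nbr i → ‖a i j‖ ≤ K * w j)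
    (hsymm : ∀ i j, j ∈ nbr i ↔ i ∈ nbr j) (hW : ∀ i, (nbr i).card ≤ W) (hLnn : 0 ≤ L)
    (hL : ∀ i j, j ∈ nbr i → w i ≤ L * w j)
    (heig : ∀ i, (ℓ i : 𝕜) * ⟪e i, f⟫_𝕜 + ∑ j ∈ nbr i, a i j * ⟪e j, f⟫_𝕜 = lam * ⟪e i, f⟫_𝕜)
    (h1 : sobSum e w 1 f ≠ ∞) (s : ℕ) : sobSum e w s f ≠ ∞ := by
  -- two-step induction on `P s := N_s < ∞ ∧ N_{s+1} < ∞`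
  have h0 : sobSum e w 0 f ≠ ∞ := by rw [sobSum_zero]; exact ENNReal.ofReal_ne_top
  have hP : ∀ s, sobSum e w s f ≠ ∞ ∧ sobSum e w (s + 1) f ≠ ∞ := by
    intro s
    induction s with
    | zero => exact ⟨h0, h1⟩
    | succ s ih =>
      refine ⟨ih.2, ?_⟩
      have hstep := sobSum_add_two_le_of_eigen hw0 hwℓ hK ha hsymm hW hLnn hL heig s
      refine ne_top_of_le_ne_top ?_ hstep
      exact ENNReal.add_ne_top.2 ⟨ENNReal.mul_ne_top ENNReal.ofReal_ne_top ih.1,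
        ENNReal.mul_ne_top ENNReal.ofReal_ne_top ih.2⟩
  exact (hP s).1

/-- **Real-valued form**: under a banded first-order perturbation, an eigenvector of `diag(ℓ) + a`
with `Σ w_i² |⟪e_i, f⟫|² < ∞` has `Σ w_i^{2s} |⟪e_i, f⟫|² < ∞` for every `s`.
[cite: Evans2010, §6.3.1 Thm 3] -/
theorem summable_weighted_of_eigen (hw0 : ∀ i, 0 ≤ w i) (hwℓ : ∀ i, w i ^ 2 ≤ 1 + |ℓ i|)
    (hK : 0 ≤ K) (ha : ∀ i j, j ∈ nbr i → ‖a i j‖ ≤ K * w j)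
    (hsymm : ∀ i j, j ∈ nbr i ↔ i ∈ nbr j) (hW : ∀ i, (nbr i).card ≤ W) (hLnn : 0 ≤ L)
    (hL : ∀ i j, j ∈ nbr i → w i ≤ L * w j)
    (heig : ∀ i, (ℓ i : 𝕜) * ⟪e i, f⟫_𝕜 + ∑ j ∈ nbr i, a i j * ⟪e j, f⟫_𝕜 = lam * ⟪e i, f⟫_𝕜)
    (h1 : Summable fun i => w i ^ 2 * ‖⟪e i, f⟫_𝕜‖ ^ 2) (s : ℕ) :
    Summable fun i => w i ^ (2 * s) * ‖⟪e i, f⟫_𝕜‖ ^ 2 := by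
  have hnn : ∀ (t : ℕ) j, 0 ≤ w j ^ (2 * t) * ‖⟪e j, f⟫_𝕜‖ ^ 2 := fun t j =>
    mul_nonneg (pow_nonneg (hw0 j) _) (sq_nonneg _)
  have h1' : sobSum e w 1 f ≠ ∞ := by
    rw [sobSum]
    have h1'' : Summable fun i => w i ^ (2 * 1) * ‖⟪e i, f⟫_𝕜‖ ^ 2 := by simpa using h1
    rw [← ENNReal.ofReal_tsum_of_nonneg (hnn 1) h1'']
    exact ENNReal.ofReal_ne_top
  have hs := sobSum_ne_top_of_eigen hw0 hwℓ hK ha hsymm hW hLnn hL heig h1' s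
  rw [sobSum] at hs
  have h := ENNReal.summable_toReal hs
  exact h.congr fun i => by rw [ENNReal.toReal_ofReal (hnn s i)]

end FirstOrderBand

end Literature.Analysis.OperatorTheory

end
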